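import Summits.QuantumFields.BalabanUV.T4Continuum.Support.VectorGaugeCovariance

/-!
# T⁴ programme, spine node NE2 (U1a), lane P2 — «V-GAUGE-COV», file 1b: EXACT GAUGE COVARIANCE OF THE CARRIERS AND AVERAGES
# (straight ∕ coarse ∕ `sites`-transported ∕ taxi ∕ line ∕ composite transports, frames, the scalar and line-sum block averages; model level; cell `pub-balaban`)

NE2 formalisation swarm `b2b-balaban-t4-ne2-formalise-*`, leaf prover 03 GEN 7 (`prover-b2b-balaban-t4-ne2-formalise-leaf-03-g7-0`); register row
«P2-sup» of `t4/formal/NE2/LEAVES.md`; journal INTENT «V-GAUGE-COV» CLAIMS.log l.19543.  On top of file 1 (`VectorGaugeCovariance`: `gaugeR`, `gaugeS`, `gaugeW`,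
`mulS`, the cancellations) and of the carriers of record BY NAME (`VariationalColourFederbush.piTv` ∕ `Qcv`, `VariationalColourTaxiTransport.{taxiAcc, taxiTv, coarseTv}`,
`VariationalColourTower.Rtrv`, `VariationalVectorFederbush.lineT`, `VectorBlockTrialForm.{QvL, compL}`, `VariationalVectorGaugeSlice.avgOp`).
 * §3 frames `gaugeF v u T′ x = v (block x) ∘ T′ x ∘ (u x)⋆` and line carriers `gaugeL v u T y j t ν = v y ∘ T y j t ν ∘ u(n·y + j + t e_ν)⋆` (DATA `def`s); laws:
   `piTv (R^u) = u(x) Π u(x + t e)⋆`, `coarseTv (R^u) = (coarseTv R)^{u∘base}`, `Rtrv (R′^u) = (Rtrv R′)^{u∘sites}`, `taxiTv (R^u) x = u(base) ∘ taxiTv R x ∘ u(x)⋆`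
   (the coarse factor is FORCED to be `u` at the base point), `lineT (T′^g) (R^u) = gaugeL v u (lineT T′ R)`, `compL (T^g) (T′^g) = (compL T T′)^g` (the intermediate
   rotation cancels; read through `sites` by `bpt_bpt_tstep`), unitarity ∕ contraction of gauged frames and carriers, INVARIANCE of the in-block mismatch norm;
 * §4 averages: `Qcv (gaugeF v u T′) (gaugeS u f) = gaugeS v (Qcv T′ f)`, hence **`ker (avgOp (gaugeF v u T′)) = (ker (avgOp T′)).map (mulS u)`** (the gauge-fixing
   kernel is transported), and **`QvL (gaugeL v u T) (gaugeW u W) = gaugeW v (QvL T W)`** (fibres map to fibres: `QvL_gauge_eq_iff`).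

HONEST FRAMING (T4-DAG p. 1).  Model level (c5): operators ∕ frames ∕ carriers DATA; a «gauge transformation» is a pair of unitary site fields acting on OUR typed
objects — no identification with Bałaban's `U` (no B0); [folklore] algebra, NO analytic content; gauge EXISTENCE not claimed; data `def`s `gaugeF`, `gaugeL` only, no
`def … : Prop`, no `sorry`; axioms standard.  V-END with background ∕ NE2 NOT proved; NE3 OPEN; spine PROVED 0∕9 unchanged; rung (B)+1 on a fixed finite T⁴ — NOT
infinite volume, NOT mass gap, NOT Clay.  HONEST DEPENDENCY (cell, verbatim): continuum YM on T⁴ ⇐ BetaPertH ∧ nine spine estimates (0/9 proved); BetaPertH ⇐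
(D1) ∧ (D4) ∧ CAP+tail; G-an2-4 gates asym, D1 and NE2/3/4.
-/

noncomputable section

namespace Summit.QuantumFields.BalabanUV.T4Continuum.VectorGaugeCovariance

open Finset
open scoped BigOperators
open Literature.MathematicalPhysics.QuantumFieldTheory.Balaban1983to89.B5Prop11Plancherel (Tor fine unitVec)
open Literature.MathematicalPhysics.QuantumFieldTheory.Balaban1983to89.B5Block118 (tstep tstep_zero tstep_succ bpt bpt_add_tstep)
open Literature.MathematicalPhysics.QuantumFieldTheory.Balaban1983to89.B5Blocks16 (blockOf blockOf_bpt)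
open Literature.MathematicalPhysics.QuantumFieldTheory.Balaban1983to89.B5Composition116 (sites J JEquiv JEquiv_apply bpt_bpt_tstep)
open Summit.QuantumFields.BalabanUV.T4Continuum.VariationalColourFederbush (cDv dirUv Qcv piTv)
open Summit.QuantumFields.BalabanUV.T4Continuum.VariationalColourBochner (Dirv DirAdjv negLapv nsqv)
open Summit.QuantumFields.BalabanUV.T4Continuum.VariationalColourInterpolant (hessv)
open Summit.QuantumFields.BalabanUV.T4Continuum.VariationalColourTower (Rtrv)
open Summit.QuantumFields.BalabanUV.T4Continuum.VariationalCovariantTower (sites_add)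
open Summit.QuantumFields.BalabanUV.T4Continuum.VariationalTower (sites_unitVec)
open Summit.QuantumFields.BalabanUV.T4Continuum.VariationalTaxiTransport (below corner corner_succ)
open Summit.QuantumFields.BalabanUV.T4Continuum.VariationalTaxiCoarse (corner_zero)
open Summit.QuantumFields.BalabanUV.T4Continuum.VariationalColourTaxiTransport (legTv taxiAcc taxiTv coarseTv)
open Summit.QuantumFields.BalabanUV.T4Continuum.VectorBlockTrialForm (nsqV QvL roughV compL val_finProdFinEquiv)
open Summit.QuantumFields.BalabanUV.T4Continuum.VariationalVectorFederbush (lineT)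
open Summit.QuantumFields.BalabanUV.T4Continuum.VariationalVectorForm (cdV curlV curlSq qWV)
open Summit.QuantumFields.BalabanUV.T4Continuum.VariationalVectorWeitzenbock (divV divSq divV_apply)
open Summit.QuantumFields.BalabanUV.T4Continuum.VariationalVectorOneStep (hessV)
open Summit.QuantumFields.BalabanUV.T4Continuum.VariationalVectorOneStepPhys (rhoV)
open Summit.QuantumFields.BalabanUV.T4Continuum.VariationalVectorGaugeSlice (avgOp avgOp_apply lapOp lapOp_apply)

variable {d : ℕ} {E : Type*} [NormedAddCommGroup E] [InnerProductSpace ℂ E] [CompleteSpace E]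

/-! ## §3 The carriers: straight, coarse, transported-along-`sites`, taxi, line, composite -/

section Carriers

variable (L : ℕ) [NeZero L] (N : Fin d → ℕ) [hN : ∀ μ, NeZero (N μ)]
variable {u : Tor (fine L N) → (E →L[ℂ] E)} (hu : ∀ x, u x ∈ unitary (E →L[ℂ] E))
include hu

omit [NeZero L] hN in
/-- **straight transporters**: `Π^{R^u}_t(x) = u(x) ∘ Π^R_t(x) ∘ u(x + t e_μ)⋆`. [folklore] -/
theorem piTv_gauge (R : Tor (fine L N) → Fin d → (E →L[ℂ] E)) (x : Tor (fine L N)) (μ : Fin d) :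
    ∀ t : ℕ, piTv L N (gaugeR (fine L N) u R) x μ t = u x * piTv L N R x μ t * star (u (x + tstep (fine L N) μ t))
  | 0 => by simp [piTv, tstep_zero, mul_star_self hu]
  | t + 1 => by
    rw [piTv, piTv_gauge R x μ t, piTv, tstep_succ, ← add_assoc]
    simp only [gaugeR, mul_assoc]
    congr 2
    rw [← mul_assoc (star (u _)), star_mul_self hu, one_mul]

omit hN in
/-- **the straight coarsening**: `coarseTv (R^u) y μ = u(L·y) ∘ coarseTv R y μ ∘ u(L·(y + e_μ))⋆` — the gauged coarse bonds with the unit-lattice field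
`y ↦ u (bpt y 0)`. [folklore] -/
theorem coarseTv_gauge (R : Tor (fine L N) → Fin d → (E →L[ℂ] E)) (y : Tor N) (μ : Fin d) :
    coarseTv L N (gaugeR (fine L N) u R) y μ = gaugeR N (fun y => u (bpt L N y 0)) (coarseTv L N R) y μ := by
  unfold coarseTv
  rw [piTv_gauge L N hu, bpt_add_tstep]
  rfl

omit hN in
/-- **the accumulated taxi transport**: `taxiAcc (R^u) y j i = u(base y) ∘ taxiAcc R y j i ∘ u(corner i)⋆`. [folklore] -/
theorem taxiAcc_gauge (R : Tor (fine L N) → Fin d → (E →L[ℂ] E)) (y : Tor N) (j : Fin d → Fin L) :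
    ∀ i : ℕ, taxiAcc L N (gaugeR (fine L N) u R) y j i = u (bpt L N y 0) * taxiAcc L N R y j i * star (u (corner L N y j i))
  | 0 => by rw [taxiAcc, taxiAcc, corner_zero, mul_one, mul_star_self hu]
  | i + 1 => by
    rw [taxiAcc, taxiAcc, taxiAcc_gauge R y j i]
    by_cases hi : i < d
    · have hleg : legTv L N (gaugeR (fine L N) u R) y j i = u (corner L N y j i) * legTv L N R y j i * star (u (corner L N y j (i + 1))) := by
        unfold legTv; rw [dif_pos hi, dif_pos hi, piTv_gauge L N hu, corner_succ L N y j hi]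
      rw [hleg]
      simp only [mul_assoc]
      congr 2
      rw [← mul_assoc (star (u _)), star_mul_self hu, one_mul]
    · have hleg : ∀ S : Tor (fine L N) → Fin d → (E →L[ℂ] E), legTv L N S y j i = 1 := fun S => by unfold legTv; rw [dif_neg hi]
      have hc : corner L N y j (i + 1) = corner L N y j i := by
        unfold corner; rw [VariationalTaxiTransport.below_of_le L j (by omega), VariationalTaxiTransport.below_of_le L j (by omega)]
      rw [hleg, hleg, mul_one, mul_one, hc]

omit hu in
/-- every fine site is `L·(blockOf x) + digits x` (as in `RegionGaugeFixedVectorFlat.bpt_blockOf_digits`, re-proved to keep the cone small). [folklore] -/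
theorem bpt_blockOf_digits' (x : Tor (fine L N)) : bpt L N (blockOf L N x) (ScalarBlockTrialFunction.digits L N x) = x := by
  unfold blockOf ScalarBlockTrialFunction.digits
  exact (Equiv.ofBijective _ (Literature.MathematicalPhysics.QuantumFieldTheory.Balaban1983to89.B5Blocks16.bpt_bijective L N)).apply_symm_apply x

/-- **THE TAXI SITE TRANSPORT**: `taxiTv (R^u) x = u(base of block x) ∘ taxiTv R x ∘ u(x)⋆` — i.e. the gauged frames `gaugeF (y ↦ u (bpt y 0)) u (taxiTv R)`
(the coarse factor is FORCED to be `u` at the base point). [folklore] -/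
theorem taxiTv_gauge (R : Tor (fine L N) → Fin d → (E →L[ℂ] E)) (x : Tor (fine L N)) :
    taxiTv L N (gaugeR (fine L N) u R) x = u (bpt L N (blockOf L N x) 0) * taxiTv L N R x * star (u x) := by
  unfold taxiTv
  rw [taxiAcc_gauge L N hu, VariationalTaxiTransport.corner_d, bpt_blockOf_digits' L N x]

end Carriers

section Frames

variable (n : ℕ) [NeZero n] (M : Fin d → ℕ) [hM : ∀ μ, NeZero (M μ)]

/-- **gauged frames** (a frame `T′ x` carries the fibre at `x` to the fibre at the base point of its block; the coarse end is rotated by `v`):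
`gaugeF v u T′ x = v (block x) ∘ T′ x ∘ (u x)⋆`. [folklore] -/
def gaugeF (v : Tor M → (E →L[ℂ] E)) (u : Tor (fine n M) → (E →L[ℂ] E)) (T' : Tor (fine n M) → (E →L[ℂ] E)) (x : Tor (fine n M)) : E →L[ℂ] E :=
  v (blockOf n M x) * T' x * star (u x)

/-- **gauged line carriers** (a carrier `T y j t ν` carries the fibre at `n·y + j + t e_ν` to the coarse fibre at `y`):
`gaugeL v u T y j t ν = v y ∘ T y j t ν ∘ u(n·y + j + t e_ν)⋆`. [folklore] -/
def gaugeL (v : Tor M → (E →L[ℂ] E)) (u : Tor (fine n M) → (E →L[ℂ] E)) (T : Tor M → (Fin d → Fin n) → Fin n → Fin d → (E →L[ℂ] E))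
    (y : Tor M) (j : Fin d → Fin n) (t : Fin n) (ν : Fin d) : E →L[ℂ] E :=
  v y * T y j t ν * star (u (bpt n M y j + tstep (fine n M) ν t))

variable {v : Tor M → (E →L[ℂ] E)} (hv : ∀ y, v y ∈ unitary (E →L[ℂ] E))
variable {u : Tor (fine n M) → (E →L[ℂ] E)} (hu : ∀ x, u x ∈ unitary (E →L[ℂ] E))

/-- the taxi law in frame letters: `taxiTv (R^u) = gaugeF (y ↦ u (bpt y 0)) u (taxiTv R)`. [folklore] -/
theorem taxiTv_gauge_eq_gaugeF (hu : ∀ x, u x ∈ unitary (E →L[ℂ] E)) (R : Tor (fine n M) → Fin d → (E →L[ℂ] E)) :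
    taxiTv n M (gaugeR (fine n M) u R) = gaugeF n M (fun y => u (bpt n M y 0)) u (taxiTv n M R) := by
  funext x; exact taxiTv_gauge n M hu R x

include hv hu

/-- gauged unitary frames are unitary. [folklore] -/
theorem gaugeF_mem_unitary {T' : Tor (fine n M) → (E →L[ℂ] E)} (hT' : ∀ x, T' x ∈ unitary (E →L[ℂ] E)) (x : Tor (fine n M)) :
    gaugeF n M v u T' x ∈ unitary (E →L[ℂ] E) :=
  mul_mem (mul_mem (hv _) (hT' x)) (Unitary.star_mem (hu x))

/-- gauged contractive frames are contractive. [folklore] -/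
theorem norm_gaugeF_le_one {T' : Tor (fine n M) → (E →L[ℂ] E)} (hT' : ∀ x, ‖T' x‖ ≤ 1) (x : Tor (fine n M)) : ‖gaugeF n M v u T' x‖ ≤ 1 := by
  unfold gaugeF
  have h1 : ‖v (blockOf n M x)‖ ≤ 1 := VariationalColourFederbush.norm_le_one_of_mem_unitary (hv _)
  have h2 : ‖star (u x)‖ ≤ 1 := VariationalColourFederbush.norm_le_one_of_mem_unitary (Unitary.star_mem (hu _))
  calc _ ≤ ‖v (blockOf n M x) * T' x‖ * ‖star (u x)‖ := norm_mul_le _ _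
    _ ≤ (‖v (blockOf n M x)‖ * ‖T' x‖) * ‖star (u x)‖ := mul_le_mul_of_nonneg_right (norm_mul_le _ _) (norm_nonneg _)
    _ ≤ (1 * 1) * 1 := by gcongr; exact hT' x
    _ = 1 := by norm_num

omit [NeZero n] hM in
/-- gauged contractive carriers are contractive. [folklore] -/
theorem norm_gaugeL_le_one {T : Tor M → (Fin d → Fin n) → Fin n → Fin d → (E →L[ℂ] E)} (hT : ∀ y j t ν, ‖T y j t ν‖ ≤ 1)
    (y : Tor M) (j : Fin d → Fin n) (t : Fin n) (ν : Fin d) : ‖gaugeL n M v u T y j t ν‖ ≤ 1 := by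
  unfold gaugeL
  have h1 : ‖v y‖ ≤ 1 := VariationalColourFederbush.norm_le_one_of_mem_unitary (hv _)
  have h2 : ‖star (u (bpt n M y j + tstep (fine n M) ν t))‖ ≤ 1 := VariationalColourFederbush.norm_le_one_of_mem_unitary (Unitary.star_mem (hu _))
  calc _ ≤ ‖v y * T y j t ν‖ * ‖star (u (bpt n M y j + tstep (fine n M) ν t))‖ := norm_mul_le _ _
    _ ≤ (‖v y‖ * ‖T y j t ν‖) * ‖star (u (bpt n M y j + tstep (fine n M) ν t))‖ := mul_le_mul_of_nonneg_right (norm_mul_le _ _) (norm_nonneg _)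
    _ ≤ (1 * 1) * 1 := by gcongr; exact hT y j t ν
    _ = 1 := by norm_num

/-- **the in-block mismatch is COVARIANT**: `R^u(x,μ) ∘ (T′^g(x+e_μ))⋆ ∘ T′^g(x) − 1 = u(x) ∘ (R(x,μ) T′(x+e_μ)⋆ T′(x) − 1) ∘ u(x)⋆` inside a block
(the coarse rotations `v` cancel), hence its norm is INVARIANT. [folklore] -/
theorem norm_mismatch_gauge (R : Tor (fine n M) → Fin d → (E →L[ℂ] E)) (T' : Tor (fine n M) → (E →L[ℂ] E))
    (x : Tor (fine n M)) (μ : Fin d) (hx : blockOf n M (x + unitVec (fine n M) μ) = blockOf n M x) :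
    ‖gaugeR (fine n M) u R x μ * star (gaugeF n M v u T' (x + unitVec (fine n M) μ)) * gaugeF n M v u T' x - 1‖
      = ‖R x μ * star (T' (x + unitVec (fine n M) μ)) * T' x - 1‖ := by
  have e : gaugeR (fine n M) u R x μ * star (gaugeF n M v u T' (x + unitVec (fine n M) μ)) * gaugeF n M v u T' x - 1
      = u x * (R x μ * star (T' (x + unitVec (fine n M) μ)) * T' x - 1) * star (u x) := by
    rw [mul_sub, sub_mul, mul_one, mul_star_self hu]
    simp only [gaugeR, gaugeF, hx, star_mul, star_star, mul_assoc]
    rw [← mul_assoc (star (u (x + unitVec (fine n M) μ))) (u (x + unitVec (fine n M) μ)), star_mul_self hu, one_mul,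
      ← mul_assoc (star (v (blockOf n M x))) (v (blockOf n M x)), star_mul_self hv, one_mul]
  rw [e]
  -- `‖w A w⋆‖ = ‖A‖` for unitary `w`
  have hle : ∀ (w : E →L[ℂ] E) (A : E →L[ℂ] E), w ∈ unitary (E →L[ℂ] E) → ‖w * A * star w‖ ≤ ‖A‖ := fun w A hw => by
    have h1 : ‖w‖ ≤ 1 := VariationalColourFederbush.norm_le_one_of_mem_unitary hw
    have h2 : ‖star w‖ ≤ 1 := VariationalColourFederbush.norm_le_one_of_mem_unitary (Unitary.star_mem hw)
    calc ‖w * A * star w‖ ≤ ‖w * A‖ * ‖star w‖ := norm_mul_le _ _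
      _ ≤ (‖w‖ * ‖A‖) * ‖star w‖ := mul_le_mul_of_nonneg_right (norm_mul_le _ _) (norm_nonneg _)
      _ ≤ (1 * ‖A‖) * 1 := by gcongr
      _ = ‖A‖ := by ring
  refine le_antisymm (hle _ _ (hu x)) ?_
  have h := hle (star (u x)) (u x * (R x μ * star (T' (x + unitVec (fine n M) μ)) * T' x - 1) * star (u x)) (Unitary.star_mem (hu x))
  have e2 : star (u x) * (u x * (R x μ * star (T' (x + unitVec (fine n M) μ)) * T' x - 1) * star (u x)) * star (star (u x))
      = R x μ * star (T' (x + unitVec (fine n M) μ)) * T' x - 1 := by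
    rw [star_star, ← mul_assoc, ← mul_assoc, star_mul_self hu, one_mul, mul_assoc, star_mul_self hu, mul_one]
  rw [e2] at h
  exact h

omit hv in
/-- **PRODUCT LINE TRANSPORTS**: `lineT (T′^g) (R^u) = gaugeL v u (lineT T′ R)`. [folklore] -/
theorem lineT_gauge (T' : Tor (fine n M) → (E →L[ℂ] E)) (R : Tor (fine n M) → Fin d → (E →L[ℂ] E)) :
    lineT n M (gaugeF n M v u T') (gaugeR (fine n M) u R) = gaugeL n M v u (lineT n M T' R) := by
  funext y j t ν
  unfold lineT gaugeL gaugeF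
  rw [piTv_gauge n M hu, blockOf_bpt]
  simp only [mul_assoc]
  congr 2
  rw [← mul_assoc (star (u _)), star_mul_self hu, one_mul]

end Frames

section Composite

variable (n L : ℕ) [NeZero n] [NeZero L] (M : Fin d → ℕ) [hM : ∀ μ, NeZero (M μ)]
variable {v : Tor M → (E →L[ℂ] E)} {w : Tor (fine n M) → (E →L[ℂ] E)} (hw : ∀ x, w x ∈ unitary (E →L[ℂ] E))
variable {u : Tor (fine L (fine n M)) → (E →L[ℂ] E)}

omit [NeZero n] [NeZero L] hM in
/-- **TRANSPORT ALONG `sites`**: `Rtrv (R′^u) = (Rtrv R′)^{u ∘ sites}`. [folklore] -/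
theorem Rtrv_gauge (R' : Tor (fine L (fine n M)) → Fin d → (E →L[ℂ] E)) :
    Rtrv n L M (gaugeR (fine L (fine n M)) u R') = gaugeR (fine (n * L) M) (fun x => u (sites n L M x)) (Rtrv n L M R') := by
  funext x μ
  simp only [Rtrv, gaugeR, sites_add, sites_unitVec]

include hw

omit [NeZero n] [NeZero L] in
/-- **COMPOSITION**: the composite of gauged carriers is the gauged composite, read on the composite torus through `sites`:
`compL (gaugeL v w T) (gaugeL w u T′) = gaugeL v (u ∘ sites) (compL T T′)` (the intermediate rotation `w` cancels). [folklore] -/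
theorem compL_gauge (T : Tor M → (Fin d → Fin n) → Fin n → Fin d → (E →L[ℂ] E))
    (T' : Tor (fine n M) → (Fin d → Fin L) → Fin L → Fin d → (E →L[ℂ] E)) :
    compL n L M (gaugeL n M v w T) (gaugeL L (fine n M) w u T') = gaugeL (n * L) M v (fun x => u (sites n L M x)) (compL n L M T T') := by
  funext y Jx Ux μ
  -- split the long offset and the long position
  obtain ⟨⟨j₂, j₁⟩, rfl⟩ := (JEquiv n L).surjective Jx
  obtain ⟨⟨t₂, t₁⟩, rfl⟩ := finProdFinEquiv.surjective Ux
  simp only [JEquiv_apply, gaugeL, VectorBlockTrialForm.compL_J, val_finProdFinEquiv, ← bpt_bpt_tstep, mul_assoc]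
  congr 2
  rw [← mul_assoc (star (w _)) (w _), star_mul_self hw, one_mul]

end Composite

/-! ## §4 The transported averages -/

section Averages

variable (n : ℕ) [NeZero n] (M : Fin d → ℕ) [hM : ∀ μ, NeZero (M μ)]
variable {v : Tor M → (E →L[ℂ] E)} {u : Tor (fine n M) → (E →L[ℂ] E)} (hu : ∀ x, u x ∈ unitary (E →L[ℂ] E))
include hu

/-- **THE SCALAR BLOCK AVERAGE IS COVARIANT**: `Qcv (gaugeF v u T′) (gaugeS u f) = gaugeS v (Qcv T′ f)`. [folklore] -/
theorem Qcv_gauge (T' : Tor (fine n M) → (E →L[ℂ] E)) (f : Tor (fine n M) → E) :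
    Qcv n M (gaugeF n M v u T') (gaugeS (fine n M) u f) = gaugeS M v (Qcv n M T' f) := by
  funext y
  simp only [Qcv, gaugeF, gaugeS, mul_apply_eq_comp, star_apply_apply hu, blockOf_bpt, map_smul, map_sum]

/-- the same for the bundled `avgOp`. [folklore] -/
theorem avgOp_gauge (T' : Tor (fine n M) → (E →L[ℂ] E)) (f : Tor (fine n M) → E) :
    avgOp n M (gaugeF n M v u T') (gaugeS (fine n M) u f) = gaugeS M v (avgOp n M T' f) := by
  rw [avgOp_apply, avgOp_apply, Qcv_gauge n M hu]

/-- **THE GAUGE-FIXING KERNEL IS TRANSPORTED**: `ker (avgOp (gaugeF v u T′)) = (ker (avgOp T′)).map (mulS u)` (for unitary `v`). [folklore] -/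
theorem ker_avgOp_gauge (hv : ∀ y, v y ∈ unitary (E →L[ℂ] E)) (T' : Tor (fine n M) → (E →L[ℂ] E)) :
    LinearMap.ker (avgOp n M (gaugeF n M v u T')) = (LinearMap.ker (avgOp n M T')).map (mulS (fine n M) u) := by
  ext g
  rw [Submodule.mem_map]
  constructor
  · intro hg
    refine ⟨gaugeS (fine n M) (fun x => star (u x)) g, ?_, gaugeS_gaugeS_star hu g⟩
    rw [LinearMap.mem_ker] at hg ⊢
    have h := avgOp_gauge n M hu (v := v) T' (gaugeS (fine n M) (fun x => star (u x)) g)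
    rw [gaugeS_gaugeS_star hu, hg] at h
    have h2 := congrArg (gaugeS M (fun y => star (v y))) h.symm
    rw [gaugeS_star_gaugeS hv] at h2
    rw [h2]; funext y; simp [gaugeS]
  · rintro ⟨f, hf, rfl⟩
    rw [LinearMap.mem_ker] at hf
    rw [LinearMap.mem_ker, mulS_apply, avgOp_gauge n M hu, hf]
    funext y; simp [gaugeS]

omit [NeZero n] hM in
/-- **THE LINE-SUM AVERAGE IS COVARIANT**: `QvL (gaugeL v u T) (gaugeW u W) = gaugeW v (QvL T W)`. [folklore] -/
theorem QvL_gauge (T : Tor M → (Fin d → Fin n) → Fin n → Fin d → (E →L[ℂ] E)) (W : Tor (fine n M) → Fin d → E) :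
    QvL n M (gaugeL n M v u T) (gaugeW (fine n M) u W) = gaugeW M v (QvL n M T W) := by
  funext y μ
  simp only [QvL, gaugeL, gaugeW, mul_apply_eq_comp, star_apply_apply hu, map_smul, map_sum]

omit [NeZero n] hM in
/-- fibres are transported: `QvL (T^g) (W^u) = (φ)^v ↔ QvL T W = φ`. [folklore] -/
theorem QvL_gauge_eq_iff (hv : ∀ y, v y ∈ unitary (E →L[ℂ] E)) (T : Tor M → (Fin d → Fin n) → Fin n → Fin d → (E →L[ℂ] E))
    (W : Tor (fine n M) → Fin d → E) (φ : Tor M → Fin d → E) :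
    QvL n M (gaugeL n M v u T) (gaugeW (fine n M) u W) = gaugeW M v φ ↔ QvL n M T W = φ := by
  rw [QvL_gauge n M hu]
  exact ⟨fun h => (gaugeW_bijective hv).1 h, fun h => by rw [h]⟩

end Averages

end Summit.QuantumFields.BalabanUV.T4Continuum.VectorGaugeCovariance

end
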